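import Literature.Probability.Percolation.IsoradialDualProofs
import Literature.Probability.LatticeModels.RhombicEmbeddingTransfer
import HarnessLib

/-!
# Tracks and the square-grid property of the dual isoradial graph

Grimmett–Manolescu (PTRF 159 (2014) = arXiv:1204.0505), §4.2: "We write `𝒯(G)` for the set of
tracks of `G`, and note that `𝒯(G) = 𝒯(G*)`", and "Since the square-grid property pertains to
the diamond graph `G^◇` rather than to `G` itself, `G` satisfies SGP(I) if and only if `G*`
satisfies SGP(I)." For an isoradial rhombic tiling `emb` (`IsIsoradial`, `IsRhombicTiling`) and
its dual embedding `emb.dual` (`IsoradialDual`, `IsoradialDualProofs`), a track is a sequence of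
rhombi — edges — stepping across common sides; the rhombus of the dual edge `e*` is the rhombus
of `e` (`rhombus_dual`) and its sides, as corner–centre pairs, are the primal sides with the two
components exchanged. Hence:

* `dartSides_dual`, `dartOppositeSide_dual`, `sides_dual`, `oppositeSide_dual` — sides of dual
  rhombi are the swapped sides of the primal rhombi;
* `isTrack_dual_iff`, `isSimpleTrack_dual_iff` — `r*` is a (simple) track of `G*` iff `e* ↦ e`
  carries it to a (simple) track of `G`;
* `IsSquareGridGM.dual`, `SquareGridPropertyGM.dual`, `HasSquareGridPropertyGM.dual` — **the
  printed square-grid property SGP(I) passes from `G` to `G*`** (clause (b) quantifies over all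
  tracks, whence both directions of `isTrack_dual_iff`).

With `isIsoradial_dual`, `isRhombicTiling_dual`, `hasBoundedAngles_dual` (`IsoradialDualProofs`)
this places `G*` in the printed class `𝒢(ε, I)` whenever `G` is, as used in the proof of
Theorem "Criticality" (end of §3: "both `P_G` and `P_{G*}` have the box-crossing property") — up to
the connectivity and countability side conditions of the tree's statements, not treated here.

## References

* G. R. Grimmett, I. Manolescu, *Bond percolation on isoradial graphs: criticality and
  universality*, PTRF 159 (2014) 273–327, arXiv:1204.0505, §4.2 (tracks; 𝒯(G) = 𝒯(G*); SGP(I)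
  for G iff for G*).
-/

noncomputable section

namespace Literature.Probability.Percolation

open Literature.Probability.LatticeModels Literature.Probability.LatticeModels.RhombicEmbedding

variable {V F : Type*} {G : SimpleGraph V} {emb : RhombicEmbedding G F}

/-! ### Sides of dual rhombi -/

/-- Exchanging the components of a corner–centre pair. [folklore] -/
def swapSide : V × F ↪ F × V := ⟨Prod.swap, Prod.swap_injective⟩

/-- `swapSide` on a pair. [folklore] -/
@[simp] theorem swapSide_apply (p : V × F) : swapSide p = (p.2, p.1) := rfl

/-- A swapped pair lies in the swapped side set. [folklore] -/
theorem swap_mem_map_swapSide {S : Finset (V × F)} {p : V × F} (h : p ∈ S) :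
    p.swap ∈ S.map swapSide :=
  Finset.mem_map_of_mem swapSide h

/-- Unswapping a member of a swapped side set. [folklore] -/
theorem swap_mem_of_mem_map_swapSide {S : Finset (V × F)} {q : F × V} (h : q ∈ S.map swapSide) :
    q.swap ∈ S := by
  obtain ⟨p, hp, rfl⟩ := Finset.mem_map.1 h
  simpa using hp

/-- Pushing a primal track to `G*` and back. [folklore] -/
theorem edgeEquivDual_symm_comp_comp (hiso : emb.IsIsoradial) (hrh : emb.IsRhombicTiling)
    (r : ℤ → G.edgeSet) :
    (edgeEquivDual hiso hrh).symm ∘ ((edgeEquivDual hiso hrh) ∘ r) = r := by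
  funext n; exact (edgeEquivDual hiso hrh).symm_apply_apply (r n)

/-- Pushing a dual track to `G` and back. [folklore] -/
theorem edgeEquivDual_comp_symm_comp (hiso : emb.IsIsoradial) (hrh : emb.IsRhombicTiling)
    (r : ℤ → emb.dualGraph.edgeSet) :
    (edgeEquivDual hiso hrh) ∘ ((edgeEquivDual hiso hrh).symm ∘ r) = r := by
  funext n; exact (edgeEquivDual hiso hrh).apply_symm_apply (r n)

section Sides

variable [DecidableEq V] [DecidableEq F]

/-- The sides of the rhombus of a dual dart are the swapped sides of the rhombus of the primal
dart it crosses. [folklore] -/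
theorem dartSides_dual (hiso : emb.IsIsoradial) (D : emb.dualGraph.Dart) :
    emb.dual.dartSides D = (emb.dartSides (emb.primalDart D)).map swapSide := by
  have hf : D.fst = emb.leftFace (emb.primalDart D) := (emb.leftFace_primalDart hiso D).symm
  have hg : D.snd = emb.rightFace (emb.primalDart D) := (emb.rightFace_primalDart hiso D).symm
  ext q
  simp only [RhombicEmbedding.dartSides, dual_leftFace, dual_rightFace, Finset.mem_insert,
    Finset.mem_singleton, Finset.mem_map, swapSide, Function.Embedding.coeFn_mk]
  rw [hf, hg]
  constructor
  · rintro (rfl | rfl | rfl | rfl)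
    · exact ⟨_, Or.inr (Or.inl rfl), rfl⟩
    · exact ⟨_, Or.inr (Or.inr (Or.inl rfl)), rfl⟩
    · exact ⟨_, Or.inr (Or.inr (Or.inr rfl)), rfl⟩
    · exact ⟨_, Or.inl rfl, rfl⟩
  · rintro ⟨p, hp, rfl⟩
    rcases hp with rfl | rfl | rfl | rfl <;> simp

/-- The opposite-side map of the rhombus of a dual dart is the conjugate by `swap` of that of
the primal dart it crosses. [folklore] -/
theorem dartOppositeSide_dual (hiso : emb.IsIsoradial) (D : emb.dualGraph.Dart) (p : V × F) :
    emb.dual.dartOppositeSide D p.swap = (emb.dartOppositeSide (emb.primalDart D) p).swap := by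
  have hf : D.fst = emb.leftFace (emb.primalDart D) := (emb.leftFace_primalDart hiso D).symm
  have hg : D.snd = emb.rightFace (emb.primalDart D) := (emb.rightFace_primalDart hiso D).symm
  rcases p with ⟨v, f⟩
  have hne := (emb.primalDart D).fst_ne_snd
  have hfg : emb.leftFace (emb.primalDart D) ≠ emb.rightFace (emb.primalDart D) :=
    fun h => hiso.c_leftFace_ne _ (congrArg emb.c h)
  simp only [RhombicEmbedding.dartOppositeSide, dual_leftFace, dual_rightFace, Prod.swap_prod_mk,
    Prod.mk.injEq]
  rw [hf, hg]
  split_ifs <;> simp_all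

/-- The sides of the rhombus of a dual edge are the swapped sides of the rhombus of the primal
edge it crosses. [folklore] -/
theorem sides_dual (hiso : emb.IsIsoradial) (hrh : emb.IsRhombicTiling)
    (z : emb.dualGraph.edgeSet) :
    emb.dual.sides z = (emb.sides ((edgeEquivDual hiso hrh).symm z)).map swapSide := by
  unfold RhombicEmbedding.sides
  rw [dartSides_dual hiso, emb.dartSides_eq_of_edge_eq hiso
    ((refDart_edge ((edgeEquivDual hiso hrh).symm z)).trans
      (edgeEquivDual_symm_apply_dart' hiso hrh z))]
  where
  /-- helper: the primal edge of `z`, as the edge of `primalDart (refDart z)`. [folklore] -/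
  edgeEquivDual_symm_apply_dart' (hiso : emb.IsIsoradial) (hrh : emb.IsRhombicTiling)
      (z : emb.dualGraph.edgeSet) :
      (((edgeEquivDual hiso hrh).symm z : G.edgeSet) : Sym2 V) =
        (emb.primalDart (refDart z)).edge := rfl

/-- The opposite-side map of the rhombus of a dual edge is the conjugate by `swap` of that of the
primal edge it crosses. [folklore] -/
theorem oppositeSide_dual (hiso : emb.IsIsoradial) (hrh : emb.IsRhombicTiling)
    (z : emb.dualGraph.edgeSet) (p : V × F) :
    emb.dual.oppositeSide z p.swap = (emb.oppositeSide ((edgeEquivDual hiso hrh).symm z) p).swap := by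
  unfold RhombicEmbedding.oppositeSide
  rw [dartOppositeSide_dual hiso, emb.dartOppositeSide_eq_of_edge_eq hiso
    ((refDart_edge ((edgeEquivDual hiso hrh).symm z)).trans rfl)]

/-! ### Tracks -/

/-- **Tracks of `G*` are the tracks of `G`**: `r*` is a track of the dual embedding iff the
sequence of primal edges crossed by it is a track of `emb` (witnessing sides swapped).
(Grimmett–Manolescu 2014, §4.2: "`𝒯(G) = 𝒯(G*)`".) [cite: GrimmettManolescu2014Isoradial, §4.2 (𝒯(G) = 𝒯(G*))] -/
theorem isTrack_dual_iff (hiso : emb.IsIsoradial) (hrh : emb.IsRhombicTiling)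
    (r : ℤ → emb.dualGraph.edgeSet) :
    emb.dual.IsTrack r ↔ emb.IsTrack ((edgeEquivDual hiso hrh).symm ∘ r) := by
  constructor
  · rintro ⟨s, hs⟩
    refine ⟨Prod.swap ∘ s, fun n => ?_⟩
    obtain ⟨h1, h2, h3, h4⟩ := hs n
    have hsw : ∀ m, s m = (Prod.swap (s m)).swap := fun m => by simp
    refine ⟨?_, ?_, ?_, ?_⟩
    · rw [sides_dual hiso hrh] at h1; exact swap_mem_of_mem_map_swapSide h1
    · rw [sides_dual hiso hrh] at h2; exact swap_mem_of_mem_map_swapSide h2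
    · exact fun h' => h3 ((edgeEquivDual hiso hrh).symm.injective h')
    · rw [hsw n, hsw (n - 1), oppositeSide_dual hiso hrh] at h4
      exact Prod.swap_injective h4
  · rintro ⟨s, hs⟩
    refine ⟨Prod.swap ∘ s, fun n => ?_⟩
    obtain ⟨h1, h2, h3, h4⟩ := hs n
    refine ⟨?_, ?_, ?_, ?_⟩
    · rw [Function.comp_apply, sides_dual hiso hrh]; exact swap_mem_map_swapSide h1
    · rw [Function.comp_apply, sides_dual hiso hrh]; exact swap_mem_map_swapSide h2
    · exact fun h' => h3 (congrArg (edgeEquivDual hiso hrh).symm h')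
    · rw [Function.comp_apply, Function.comp_apply, oppositeSide_dual hiso hrh]
      exact congrArg Prod.swap h4

/-- Simple tracks of `G*` are the simple tracks of `G`. [cite: GrimmettManolescu2014Isoradial, §4.2 (𝒯(G) = 𝒯(G*))] -/
theorem isSimpleTrack_dual_iff (hiso : emb.IsIsoradial) (hrh : emb.IsRhombicTiling)
    (r : ℤ → emb.dualGraph.edgeSet) :
    emb.dual.IsSimpleTrack r ↔ emb.IsSimpleTrack ((edgeEquivDual hiso hrh).symm ∘ r) := by
  unfold RhombicEmbedding.IsSimpleTrack
  rw [isTrack_dual_iff hiso hrh, (edgeEquivDual hiso hrh).symm.injective.of_comp_iff]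

/-! ### The square-grid property -/

/-- **A printed square grid of `G` is a printed square grid of `G*`** (pushed along `e ↦ e*`):
clauses (a) and (c) are invariant under the bijection of edges, and clause (b), which quantifies
over all tracks, uses both directions of `isTrack_dual_iff`. (Grimmett–Manolescu 2014, §4.2:
"`G` satisfies SGP(I) if and only if `G*` satisfies SGP(I)".) [cite: GrimmettManolescu2014Isoradial, §4.2 (SGP(I) for G iff for G*)] -/
theorem _root_.Literature.Probability.LatticeModels.RhombicEmbedding.IsSquareGridGM.dual (hiso : emb.IsIsoradial) (hrh : emb.IsRhombicTiling)
    {s t : ℤ → ℤ → G.edgeSet} {I : ℕ} (hst : emb.IsSquareGridGM s t I) :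
    emb.dual.IsSquareGridGM (fun i => (edgeEquivDual hiso hrh) ∘ s i)
      (fun j => (edgeEquivDual hiso hrh) ∘ t j) I := by
  set E := edgeEquivDual hiso hrh with hE
  have hg : Function.Injective E := E.injective
  refine ⟨fun i => ?_, fun j => ?_, ?_, ?_, fun i j => ?_, fun r₀ hr₀ hnr => ?_,
    fun r₀ hr₀ hnr => ?_, fun i j => ?_, fun i j => ?_⟩
  · rw [isSimpleTrack_dual_iff hiso hrh, edgeEquivDual_symm_comp_comp]
    exact hst.isSimpleTrack_left i
  · rw [isSimpleTrack_dual_iff hiso hrh, edgeEquivDual_symm_comp_comp]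
    exact hst.isSimpleTrack_right j
  · intro i j hij
    rw [trackMeets_comp_iff hg]
    exact hst.pairwise_not_trackMeets_left hij
  · intro i j hij
    rw [trackMeets_comp_iff hg]
    exact hst.pairwise_not_trackMeets_right hij
  · rw [isReparametrization_comp_iff hg]
    exact hst.not_isReparametrization i j
  · have hr : emb.IsTrack (E.symm ∘ r₀) := (isTrack_dual_iff hiso hrh r₀).1 hr₀
    have hr₀' : r₀ = E ∘ (E.symm ∘ r₀) := (edgeEquivDual_comp_symm_comp hiso hrh r₀).symm
    have hnr' : ∀ i, ¬ IsReparametrization (E.symm ∘ r₀) (s i) := fun i hi =>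
      hnr i (by rw [hr₀']; exact (isReparametrization_comp_iff hg _ _).2 hi)
    have := hst.crossesInOrder_left _ hr hnr'
    rw [hr₀', crossesInOrder_comp_iff hg]
    exact this
  · have hr : emb.IsTrack (E.symm ∘ r₀) := (isTrack_dual_iff hiso hrh r₀).1 hr₀
    have hr₀' : r₀ = E ∘ (E.symm ∘ r₀) := (edgeEquivDual_comp_symm_comp hiso hrh r₀).symm
    have hnr' : ∀ j, ¬ IsReparametrization (E.symm ∘ r₀) (t j) := fun j hj =>
      hnr j (by rw [hr₀']; exact (isReparametrization_comp_iff hg _ _).2 hj)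
    have := hst.crossesInOrder_right _ hr hnr'
    rw [hr₀', crossesInOrder_comp_iff hg]
    exact this
  · simpa only [trackBetween_comp hg] using hst.encard_trackBetween_left_lt i j
  · simpa only [trackBetween_comp hg] using hst.encard_trackBetween_right_lt i j

/-- **SGP(I) passes from `G` to `G*`.** (Grimmett–Manolescu 2014, §4.2.) [cite: GrimmettManolescu2014Isoradial, §4.2 (SGP(I) for G iff for G*)] -/
theorem _root_.Literature.Probability.LatticeModels.RhombicEmbedding.SquareGridPropertyGM.dual
    (hiso : emb.IsIsoradial) (hrh : emb.IsRhombicTiling) {I : ℕ}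
    (h : emb.SquareGridPropertyGM I) : emb.dual.SquareGridPropertyGM I := by
  obtain ⟨s, t, hst⟩ := h
  exact ⟨_, _, hst.dual hiso hrh⟩

/-- **The printed square-grid property passes from `G` to `G*`.** (Grimmett–Manolescu 2014,
§4.2.) [cite: GrimmettManolescu2014Isoradial, §4.2 (SGP(I) for G iff for G*)] -/
theorem _root_.Literature.Probability.LatticeModels.RhombicEmbedding.HasSquareGridPropertyGM.dual
    (hiso : emb.IsIsoradial) (hrh : emb.IsRhombicTiling)
    (h : emb.HasSquareGridPropertyGM) : emb.dual.HasSquareGridPropertyGM := by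
  obtain ⟨I, hI⟩ := h
  exact ⟨I, hI.dual hiso hrh⟩

end Sides

end Literature.Probability.Percolation

end
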